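import Literature.NumberTheory.LFunctions.DobnerSteepestDescent
import Literature.NumberTheory.LFunctions.DobnerNewmanProofs
import Mathlib.NumberTheory.ZetaValues
import Mathlib.Analysis.SpecialFunctions.Gamma.Beta
import HarnessLib

/-!
# Dobner's Thm. 4 (qualitative) from Lemma 4 — §4.1 of the source

Trunk T-ANT (`Literature/NumberTheory/LFunctions`). Proofs only, companion of
`DobnerSteepestDescent.lean`: the summation argument of §4.1 of A. Dobner, Acta Arith. 201 (2021)
= arXiv:2005.05142, deducing the qualitative Thm. 4 (`Literature.NumberTheory.LFunctions.dobner_xiDeformed_approx`, the last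
named fact of Dobner's route to `Λ ≥ 0` in `DobnerNewmanProofs.lean`) from Lemma 4
(`Literature.NumberTheory.LFunctions.dobner_lemma4`) and the series representation `ξ_t(J_t(s)) = Σ_n B_{t,n}(s)`
(`Literature.NumberTheory.LFunctions.xiDeformed_dobnerJ_eq_tsum_dobnerB`, proved). The lower bound `|γ_t(s)| ≫ e^{−K'y}` of
eq. (4.9), which the source takes from Lemma 1 (Stirling), is replaced here by an elementary
estimate on vertical strips (`exists_exp_neg_le_norm_xiGammaFactor`: reflection formula and the
recurrence of `Γ`), which is all the qualitative theorem needs; so Lemma 1 is not an input.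

## Main results

* `Literature.NumberTheory.LFunctions.exists_exp_neg_le_norm_xiGammaFactor` — `e^{−K' Im s} ≤ |γ(s)|` on vertical strips (proved).
* `Literature.dobner_xiDeformed_approx_of_lemma4 : dobner_lemma4 → dobner_xiDeformed_approx`.
* `Literature.RH.rodgers_tao_of_dobner_lemma4 : dobner_lemma4 → RH.rodgers_tao` — **Newman's conjecture
  from Dobner's Lemma 4 alone**.
-/

noncomputable section

open Complex Filter Set Topology Finset

namespace Literature.NumberTheory.LFunctions

/-! ## Preliminaries -/

/-- The main term of Lemma 4 (i) is `γ_t(s)` times the `n`-th term of `ζ_t(s)`. [folklore] -/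
theorem dobnerMainTerm_eq {t : ℝ} (ht : t < 0) (n : ℕ) {s : ℂ} (hs : s ≠ 0) :
    dobnerMainTerm t n s = dobnerGammaT t s * LSeries.term (zetaDeformedCoeff t) s n := by
  rcases Nat.eq_zero_or_pos n with rfl | hn
  · simp [dobnerMainTerm, Complex.zero_cpow (neg_ne_zero.2 hs)]
  have e : Complex.exp (-(|t| / 4 * Real.log n ^ 2 : ℝ)) = ((Real.exp (t / 4 * Real.log n ^ 2) : ℝ) : ℂ) := by
    rw [Complex.ofReal_exp, abs_of_neg ht]
    congr 1
    push_cast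
    ring
  rw [dobnerMainTerm, e, LSeries.term_of_ne_zero hn.ne', zetaDeformedCoeff, Complex.cpow_neg,
    div_eq_mul_inv]
  ring

/-- `e^{−c log² n} = n^{−c log n}` for `n ≥ 1`. [folklore] -/
theorem exp_neg_mul_log_sq {n : ℕ} (hn : 1 ≤ n) (c : ℝ) :
    Real.exp (-c * Real.log n ^ 2) = (n : ℝ) ^ (-c * Real.log n) := by
  have hnpos : (0 : ℝ) < n := by exact_mod_cast hn
  rw [Real.rpow_def_of_pos hnpos]
  congr 1
  ring

/-- For `n ≥ 2` and `p ≥ 2`: `n^{−p} ≤ n^{−2} 2^{−(p−2)}`. [folklore] -/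
theorem rpow_neg_le_inv_sq_mul {n : ℕ} (hn : 2 ≤ n) {p : ℝ} (hp : 2 ≤ p) :
    (n : ℝ) ^ (-p) ≤ (n : ℝ) ^ (-2 : ℝ) * (2 : ℝ) ^ (-(p - 2)) := by
  have hn' : (2 : ℝ) ≤ n := by exact_mod_cast hn
  have hnpos : (0 : ℝ) < n := by linarith
  rw [show -p = -2 + -(p - 2) by ring, Real.rpow_add hnpos]
  refine mul_le_mul_of_nonneg_left ?_ (Real.rpow_nonneg hnpos.le _)
  rw [Real.rpow_neg hnpos.le, Real.rpow_neg (by norm_num : (0 : ℝ) ≤ 2)]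
  exact inv_anti₀ (Real.rpow_pos_of_pos (by norm_num) _)
    (Real.rpow_le_rpow (by norm_num) hn' (by linarith))

/-- `Σ_n n^{-2} ≤ 2` (indeed `= π²/6`). [folklore] -/
theorem tsum_nat_rpow_neg_two_le : ∑' n : ℕ, (n : ℝ) ^ (-2 : ℝ) ≤ 2 := by
  have h := hasSum_zeta_two
  have e : (fun n : ℕ ↦ (n : ℝ) ^ (-2 : ℝ)) = fun n : ℕ ↦ (1 : ℝ) / (n : ℝ) ^ 2 := by
    funext n
    rw [Real.rpow_neg n.cast_nonneg, show (2 : ℝ) = ((2 : ℕ) : ℝ) by norm_num, Real.rpow_natCast,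
      one_div]
  rw [e, h.tsum_eq]
  have : Real.pi ^ 2 ≤ 12 := by nlinarith [Real.pi_lt_d2, Real.pi_pos]
  linarith

/-- Summability of `n^{-2}` (real powers). [folklore] -/
theorem summable_nat_rpow_neg_two : Summable fun n : ℕ ↦ (n : ℝ) ^ (-2 : ℝ) :=
  Real.summable_nat_rpow.2 (by norm_num)

/-- The real part of `(s − J_t(s))²/|t|` is bounded below: `≥ −π²|t|/16`
(`s − J_t(s) = −(|t|/4) Log(s/2π)` and `Re(Log²) ≥ −Arg² ≥ −π²`). [cite: Dobner2021, §4 (proof of eq. (4.9))] -/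
theorem re_sq_sub_dobnerJ_ge (t : ℝ) (s : ℂ) :
    -(Real.pi ^ 2 * |t| / 16) ≤ ((1 / |t| : ℝ) * (s - dobnerJ t s) ^ 2).re := by
  rcases eq_or_ne t 0 with rfl | ht
  · simp
  have ht' : 0 < |t| := abs_pos.2 ht
  have e : s - dobnerJ t s = -((|t| / 4 : ℝ) : ℂ) * Complex.log (s / (2 * Real.pi)) := by
    rw [dobnerJ]; ring
  rw [e]
  set L := Complex.log (s / (2 * Real.pi)) with hL
  have hsq : ((1 / |t| : ℝ) * (-((|t| / 4 : ℝ) : ℂ) * L) ^ 2).re = |t| / 16 * (L.re ^ 2 - L.im ^ 2) := by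
    have : ((1 / |t| : ℝ) : ℂ) * (-((|t| / 4 : ℝ) : ℂ) * L) ^ 2 = ((|t| / 16 : ℝ) : ℂ) * L ^ 2 := by
      push_cast
      field_simp
      ring
    rw [this, Complex.re_ofReal_mul, sq, Complex.mul_re]
    ring
  rw [hsq]
  have him : L.im ^ 2 ≤ Real.pi ^ 2 := by
    rw [hL, Complex.log_im]
    have h1 := Complex.neg_pi_lt_arg (s / (2 * Real.pi))
    have h2 := Complex.arg_le_pi (s / (2 * Real.pi))
    nlinarith
  nlinarith [sq_nonneg L.re]

/-- A lower bound for the real part of `J_t(s)`: `Re J_t(s) ≥ Re s + (|t|/4) log(Im s/(2π))` when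
`Im s > 0`. [folklore] -/
theorem le_dobnerJ_re (t : ℝ) {s : ℂ} (hs : 0 < s.im) :
    s.re + |t| / 4 * Real.log (s.im / (2 * Real.pi)) ≤ (dobnerJ t s).re := by
  rw [dobnerJ, Complex.add_re, Complex.re_ofReal_mul, Complex.log_re]
  have hn : s.im ≤ ‖s / (2 * Real.pi)‖ * (2 * Real.pi) := by
    rw [norm_div, show ‖(2 * (Real.pi : ℂ))‖ = 2 * Real.pi by
      rw [show (2 * (Real.pi : ℂ)) = ((2 * Real.pi : ℝ) : ℂ) by push_cast; rfl, Complex.norm_real,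
        Real.norm_eq_abs, abs_of_pos (by positivity)], div_mul_cancel₀ _ (by positivity)]
    exact (Complex.abs_im_le_norm s).trans' (le_abs_self _)
  have hpos : 0 < s.im / (2 * Real.pi) := by positivity
  have hle : s.im / (2 * Real.pi) ≤ ‖s / (2 * Real.pi)‖ := by
    rw [div_le_iff₀ (by positivity)]; exact hn
  have := Real.log_le_log hpos hle
  have ht0 : 0 ≤ |t| / 4 := by positivity
  nlinarith


/-! ## An elementary lower bound for `|Γ|` on vertical half-lines -/

/-- Base case: for `0 ≤ Re w < 1` and `Im w ≥ 1`, `‖Γ(w)‖ ≥ π e^{−π Im w}` (reflection formula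
`Γ(w)Γ(1−w) = π/sin(πw)`, `|sin(πw)| ≤ e^{π Im w}`, and `|Γ(1−w)| = |Γ(2−w)|/|1−w| ≤ Γ(2 − Re w)/Im w ≤ 1`).
[folklore] -/
theorem norm_Gamma_ge_of_re_mem_Ico {w : ℂ} (h0 : 0 ≤ w.re) (h1 : w.re < 1) (hτ : 1 ≤ w.im) :
    Real.pi * Real.exp (-(Real.pi * w.im)) ≤ ‖Complex.Gamma w‖ := by
  have hτ0 : 0 < w.im := by linarith
  -- `1 - w ≠ 0`, `sin (π w) ≠ 0`
  have h1w : 1 - w ≠ 0 := fun h ↦ by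
    have := congrArg Complex.im h; simp at this; linarith
  have hΓ1 : Complex.Gamma (1 - w) ≠ 0 := Complex.Gamma_ne_zero fun m h ↦ by
    have := congrArg Complex.im h; simp at this; linarith
  have hrefl := Complex.Gamma_mul_Gamma_one_sub w
  have hsin : Complex.sin (Real.pi * w) ≠ 0 := by
    intro h
    rw [h, div_zero, mul_eq_zero] at hrefl
    rcases hrefl with h' | h'
    · exact Complex.Gamma_ne_zero (fun m hm ↦ by
        have := congrArg Complex.im hm; simp at this; linarith) h'
    · exact hΓ1 h'
  -- `‖Γ(1 - w)‖ ≤ 1`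
  have hΓ1le : ‖Complex.Gamma (1 - w)‖ ≤ 1 := by
    have hrec := Complex.Gamma_add_one (1 - w) h1w
    rw [show (1 - w + 1 : ℂ) = 2 - w by ring] at hrec
    have hnorm : ‖Complex.Gamma (2 - w)‖ = ‖1 - w‖ * ‖Complex.Gamma (1 - w)‖ := by
      rw [hrec, norm_mul]
    have h2 : ‖Complex.Gamma (2 - w)‖ ≤ 1 := by
      have := norm_Gamma_le_Gamma_re (s := 2 - w) (by simp; linarith)
      refine this.trans (Real.Gamma_le_one_of_mem_Icc (by simp; linarith) (by simp; linarith))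
    have h3 : 1 ≤ ‖1 - w‖ := by
      have := Complex.abs_im_le_norm (1 - w)
      simp at this
      rw [abs_of_pos hτ0] at this
      linarith
    have h4 : 0 < ‖1 - w‖ := by linarith
    rw [hnorm] at h2
    by_contra hcon
    push Not at hcon
    have : 1 < ‖1 - w‖ * ‖Complex.Gamma (1 - w)‖ := by nlinarith
    linarith
  -- `‖sin (π w)‖ ≤ e^{π Im w}`
  have hsinle : ‖Complex.sin (Real.pi * w)‖ ≤ Real.exp (Real.pi * w.im) := by
    have := norm_sin_le_exp_abs_im (Real.pi * w)
    rwa [show ((Real.pi : ℂ) * w).im = Real.pi * w.im by simp,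
      abs_of_pos (mul_pos Real.pi_pos hτ0)] at this
  -- combine
  have hnorm : ‖Complex.Gamma w‖ * ‖Complex.Gamma (1 - w)‖ = Real.pi / ‖Complex.sin (Real.pi * w)‖ := by
    rw [← norm_mul, hrefl, norm_div, Complex.norm_real, Real.norm_eq_abs, abs_of_pos Real.pi_pos]
  have hsinpos : 0 < ‖Complex.sin (Real.pi * w)‖ := norm_pos_iff.2 hsin
  have key : Real.pi / Real.exp (Real.pi * w.im) ≤ ‖Complex.Gamma w‖ * ‖Complex.Gamma (1 - w)‖ := by
    rw [hnorm]
    exact div_le_div_of_nonneg_left Real.pi_pos.le hsinpos hsinle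
  have hΓ0 : 0 ≤ ‖Complex.Gamma w‖ := norm_nonneg _
  calc Real.pi * Real.exp (-(Real.pi * w.im)) = Real.pi / Real.exp (Real.pi * w.im) := by
        rw [Real.exp_neg, div_eq_mul_inv]
    _ ≤ ‖Complex.Gamma w‖ * ‖Complex.Gamma (1 - w)‖ := key
    _ ≤ ‖Complex.Gamma w‖ * 1 := mul_le_mul_of_nonneg_left hΓ1le hΓ0
    _ = ‖Complex.Gamma w‖ := mul_one _

/-- Shift to the right: for `m ≤ Re w < m + 1` (`m : ℕ`) and `Im w ≥ 1`, `‖Γ(w)‖ ≥ π e^{−π Im w}`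
(`Γ(w) = (w−1)Γ(w−1)`, `|w − 1| ≥ Im w ≥ 1`). [folklore] -/
theorem norm_Gamma_ge_of_re_nonneg (m : ℕ) :
    ∀ {w : ℂ}, (m : ℝ) ≤ w.re → w.re < m + 1 → 1 ≤ w.im →
      Real.pi * Real.exp (-(Real.pi * w.im)) ≤ ‖Complex.Gamma w‖ := by
  induction m with
  | zero => intro w h0 h1 hτ; exact norm_Gamma_ge_of_re_mem_Ico (by simpa using h0) (by simpa using h1) hτ
  | succ m ih =>
    intro w h0 h1 hτ
    have hw1 : w - 1 ≠ 0 := fun h ↦ by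
      have := congrArg Complex.im h; simp at this; linarith
    have hrec := Complex.Gamma_add_one (w - 1) hw1
    rw [sub_add_cancel] at hrec
    have hih := ih (w := w - 1) (by push_cast at h0 ⊢; simp; linarith) (by push_cast at h1 ⊢; simp; linarith)
      (by simpa using hτ)
    rw [hrec, norm_mul]
    have hge1 : 1 ≤ ‖w - 1‖ := by
      have := Complex.abs_im_le_norm (w - 1)
      simp at this
      rw [abs_of_pos (by linarith : 0 < w.im)] at this
      linarith
    have : Real.pi * Real.exp (-(Real.pi * (w - 1).im)) = Real.pi * Real.exp (-(Real.pi * w.im)) := by simp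
    rw [this] at hih
    calc Real.pi * Real.exp (-(Real.pi * w.im)) ≤ ‖Complex.Gamma (w - 1)‖ := hih
      _ ≤ ‖w - 1‖ * ‖Complex.Gamma (w - 1)‖ := le_mul_of_one_le_left (norm_nonneg _) hge1

/-- Shift to the left: for `−m ≤ Re w < −m + 1` (`m : ℕ`), `|Re w| ≤ S`, `Im w ≥ 1`,
`‖Γ(w)‖ ≥ π e^{−π Im w} (S + m + Im w)^{−m}` (`Γ(w) = Γ(w+1)/w`, `|w| ≤ S + m + Im w`). [folklore] -/
theorem norm_Gamma_ge_of_re_neg (m : ℕ) :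
    ∀ {w : ℂ} {S : ℝ}, |w.re| ≤ S → -(m : ℝ) ≤ w.re → w.re < -m + 1 → 1 ≤ w.im →
      Real.pi * Real.exp (-(Real.pi * w.im)) * (S + m + w.im) ^ (-(m : ℝ)) ≤ ‖Complex.Gamma w‖ := by
  induction m with
  | zero =>
    intro w S hS h0 h1 hτ
    simp only [Nat.cast_zero, neg_zero, Real.rpow_zero, mul_one] at h0 h1 ⊢
    exact norm_Gamma_ge_of_re_mem_Ico h0 (by linarith) hτ
  | succ m ih =>
    intro w S hS h0 h1 hτ
    have hτ0 : 0 < w.im := by linarith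
    have hw0 : w ≠ 0 := fun h ↦ by rw [h] at hτ0; simp at hτ0
    have hrec := Complex.Gamma_add_one w hw0
    -- `Γ w = Γ (w + 1) / w`
    have hS' : |(w + 1).re| ≤ S + 1 := by
      simp only [Complex.add_re, Complex.one_re]
      calc |w.re + 1| ≤ |w.re| + |(1 : ℝ)| := abs_add_le _ _
        _ ≤ S + 1 := by simp; linarith
    have hih := ih (w := w + 1) (S := S + 1) hS' (by push_cast at h0 ⊢; simp; linarith)
      (by push_cast at h1 ⊢; simp; linarith) (by simpa using hτ)
    have hwn : ‖w‖ ≤ S + (m + 1) + w.im := by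
      calc ‖w‖ ≤ |w.re| + |w.im| := Complex.norm_le_abs_re_add_abs_im w
        _ ≤ S + w.im := by rw [abs_of_pos hτ0]; linarith
        _ ≤ S + (m + 1) + w.im := by linarith [m.cast_nonneg (α := ℝ)]
    have hwpos : 0 < ‖w‖ := norm_pos_iff.2 hw0
    have hΓw : ‖Complex.Gamma w‖ = ‖Complex.Gamma (w + 1)‖ / ‖w‖ := by
      rw [hrec, norm_mul, mul_div_cancel_left₀ _ hwpos.ne']
    rw [hΓw, le_div_iff₀ hwpos]
    have him : (w + 1).im = w.im := by simp
    rw [him] at hih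
    -- `(S+(m+1)+τ)^{-(m+1)} · ‖w‖ ≤ (S+1+m+τ)^{-m}`
    set T : ℝ := S + (m + 1 : ℕ) + w.im with hT
    have hT' : (S + 1 + m + w.im : ℝ) = T := by rw [hT]; push_cast; ring
    have hTpos : 0 < T := by rw [hT]; push_cast; linarith [abs_nonneg w.re, m.cast_nonneg (α := ℝ)]
    have hpow : T ^ (-((m + 1 : ℕ) : ℝ)) * ‖w‖ ≤ (S + 1 + m + w.im) ^ (-(m : ℝ)) := by
      rw [hT', show -((m + 1 : ℕ) : ℝ) = -(m : ℝ) + (-1) by push_cast; ring, Real.rpow_add hTpos,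
        Real.rpow_neg_one, mul_assoc]
      refine mul_le_of_le_one_right (Real.rpow_nonneg hTpos.le _) ?_
      rw [inv_mul_le_iff₀ hTpos, mul_one]
      rw [hT]; push_cast; exact hwn
    calc Real.pi * Real.exp (-(Real.pi * w.im)) * T ^ (-((m + 1 : ℕ) : ℝ)) * ‖w‖
        = Real.pi * Real.exp (-(Real.pi * w.im)) * (T ^ (-((m + 1 : ℕ) : ℝ)) * ‖w‖) := by ring
      _ ≤ Real.pi * Real.exp (-(Real.pi * w.im)) * (S + 1 + m + w.im) ^ (-(m : ℝ)) :=
          mul_le_mul_of_nonneg_left hpow (by positivity)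
      _ ≤ ‖Complex.Gamma (w + 1)‖ := by convert hih using 2

/-- Uniform version on a vertical half-strip: for `|Re w| ≤ S` (`S ≥ 0`), `Im w ≥ 1` and
`N = ⌈S⌉₊ + 1`: `‖Γ(w)‖ ≥ π e^{−π Im w} (S + N + Im w)^{−N}`. [folklore] -/
theorem norm_Gamma_ge_uniform {S : ℝ} (hS : 0 ≤ S) {w : ℂ} (hw : |w.re| ≤ S) (hτ : 1 ≤ w.im) :
    Real.pi * Real.exp (-(Real.pi * w.im)) * (S + (⌈S⌉₊ + 1 : ℕ) + w.im) ^ (-((⌈S⌉₊ + 1 : ℕ) : ℝ)) ≤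
      ‖Complex.Gamma w‖ := by
  set N : ℕ := ⌈S⌉₊ + 1 with hN
  have hτ0 : 0 < w.im := by linarith
  have hbase1 : 1 ≤ S + N + w.im := by rw [hN]; push_cast; linarith [Nat.le_ceil S]
  have hfac_le_one : (S + N + w.im) ^ (-(N : ℝ)) ≤ 1 :=
    Real.rpow_le_one_of_one_le_of_nonpos hbase1 (by simp)
  have hfac_nn : 0 ≤ (S + N + w.im) ^ (-(N : ℝ)) := Real.rpow_nonneg (by linarith) _
  rcases le_or_gt 0 w.re with hre | hre
  · -- `Re w ≥ 0`
    have h := norm_Gamma_ge_of_re_nonneg ⌊w.re⌋₊ (w := w) (Nat.floor_le hre) (Nat.lt_floor_add_one w.re) hτ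
    calc Real.pi * Real.exp (-(Real.pi * w.im)) * (S + N + w.im) ^ (-(N : ℝ))
        ≤ Real.pi * Real.exp (-(Real.pi * w.im)) * 1 :=
          mul_le_mul_of_nonneg_left hfac_le_one (by positivity)
      _ ≤ ‖Complex.Gamma w‖ := by rw [mul_one]; exact h
  · -- `Re w < 0`: `m = ⌈-Re w⌉₊ ≤ N`
    set m : ℕ := ⌈-w.re⌉₊ with hm
    have hm1 : -(m : ℝ) ≤ w.re := by have := Nat.le_ceil (-w.re); rw [← hm] at this; linarith
    have hm2 : w.re < -(m : ℝ) + 1 := by have := Nat.ceil_lt_add_one (show 0 ≤ -w.re by linarith); rw [← hm] at this; linarith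
    have hmN : m ≤ N := by
      rw [hm, hN]
      have : -w.re ≤ S := by linarith [neg_abs_le w.re, (abs_le.1 hw).1]
      exact (Nat.ceil_mono this).trans (Nat.le_succ _)
    have h := norm_Gamma_ge_of_re_neg m (w := w) (S := S) hw hm1 hm2 hτ
    -- compare the polynomial factors
    have hmN' : (m : ℝ) ≤ N := by exact_mod_cast hmN
    have h1 : (S + N + w.im) ^ (-(N : ℝ)) ≤ (S + m + w.im) ^ (-(m : ℝ)) := by
      have hbm : 1 ≤ S + m + w.im := by linarith [m.cast_nonneg (α := ℝ)]
      calc (S + N + w.im) ^ (-(N : ℝ)) ≤ (S + N + w.im) ^ (-(m : ℝ)) :=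
            Real.rpow_le_rpow_of_exponent_le hbase1 (by linarith)
        _ ≤ (S + m + w.im) ^ (-(m : ℝ)) :=
            Real.rpow_le_rpow_of_nonpos (by linarith) (by linarith) (by simp)
    calc Real.pi * Real.exp (-(Real.pi * w.im)) * (S + N + w.im) ^ (-(N : ℝ))
        ≤ Real.pi * Real.exp (-(Real.pi * w.im)) * (S + m + w.im) ^ (-(m : ℝ)) :=
          mul_le_mul_of_nonneg_left h1 (by positivity)
      _ ≤ ‖Complex.Gamma w‖ := h

/-- **An elementary substitute for the lower half of Dobner's Lemma 1 on a vertical strip**: for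
real `a ≤ b` there are `K' > 0` and `y₀` with `e^{−K' Im s} ≤ |γ(s)|` whenever `a ≤ Re s ≤ b` and
`Im s ≥ y₀` (`γ(s) = ½ s(s−1) π^{-s/2} Γ(s/2)`; reflection formula and the recurrence of `Γ`, no
Stirling). [folklore] -/
theorem exists_exp_neg_le_norm_xiGammaFactor (a b : ℝ) :
    ∃ K' y₀ : ℝ, 0 < K' ∧ ∀ s : ℂ, a ≤ s.re → s.re ≤ b → y₀ ≤ s.im →
      Real.exp (-K' * s.im) ≤ ‖xiGammaFactor s‖ := by
  set A : ℝ := max |a| |b| with hA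
  have hA0 : 0 ≤ A := le_max_of_le_left (abs_nonneg a)
  set S : ℝ := A / 2 with hSdef
  have hS0 : 0 ≤ S := by positivity
  set N : ℕ := ⌈S⌉₊ + 1 with hN
  -- the constant `c = π^{1 - A/2} e^{-N(S+N)}` and the rate `K = π/2 + N/2`
  set c : ℝ := Real.pi ^ (-A / 2) * Real.pi * Real.exp (-(N * (S + N))) with hc
  have hcpos : 0 < c := by positivity
  set K : ℝ := Real.pi / 2 + N / 2 with hK
  refine ⟨K + 1, max 2 (Real.log (1 / c)), by positivity, fun s ha hb hy ↦ ?_⟩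
  have hy2 : 2 ≤ s.im := (le_max_left _ _).trans hy
  have hylog : Real.log (1 / c) ≤ s.im := (le_max_right _ _).trans hy
  have hy0 : 0 < s.im := by linarith
  -- `|Re s| ≤ A`
  have hxA : |s.re| ≤ A := by
    rw [abs_le]; constructor
    · linarith [neg_abs_le a, le_max_left |a| |b|]
    · linarith [le_abs_self b, le_max_right |a| |b|]
  -- the factor `Γ(s/2)`
  set w : ℂ := s / 2 with hw
  have hwre : w.re = s.re / 2 := by simp [hw]
  have hwim : w.im = s.im / 2 := by simp [hw]
  have hwS : |w.re| ≤ S := by rw [hwre, hSdef, abs_div, abs_two]; linarith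
  have hwτ : 1 ≤ w.im := by rw [hwim]; linarith
  have hΓ := norm_Gamma_ge_uniform hS0 hwS hwτ
  rw [← hN] at hΓ
  -- `(S + N + τ)^{-N} ≥ e^{-N (S + N + τ)}`
  have hpoly : Real.exp (-(N * (S + N + w.im))) ≤ (S + N + w.im) ^ (-(N : ℝ)) := by
    have hu : 1 ≤ S + N + w.im := by rw [hN]; push_cast; linarith [Nat.le_ceil S]
    have hu0 : 0 < S + N + w.im := by linarith
    rw [Real.rpow_neg hu0.le, Real.exp_neg]
    refine inv_anti₀ (Real.rpow_pos_of_pos hu0 _) ?_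
    calc (S + N + w.im) ^ (N : ℝ) ≤ (Real.exp (S + N + w.im)) ^ (N : ℝ) :=
          Real.rpow_le_rpow hu0.le (by linarith [Real.add_one_le_exp (S + N + w.im)]) N.cast_nonneg
      _ = Real.exp (N * (S + N + w.im)) := by rw [← Real.exp_mul]; ring_nf
  -- the polynomial prefactor `|s(s-1)/2| ≥ 1` and `|π^{-s/2}| ≥ π^{-A/2}`
  have hs1 : 1 ≤ ‖s * (s - 1) / 2‖ := by
    rw [norm_div, norm_mul, Complex.norm_two]
    have h1 : s.im ≤ ‖s‖ := (le_abs_self _).trans (Complex.abs_im_le_norm s)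
    have h2 : s.im ≤ ‖s - 1‖ := by
      have := Complex.abs_im_le_norm (s - 1); simp at this; exact (le_abs_self _).trans this
    rw [le_div_iff₀ two_pos]
    nlinarith [norm_nonneg s, norm_nonneg (s - 1)]
  have hπ : Real.pi ^ (-A / 2) ≤ ‖(Real.pi : ℂ) ^ (-s / 2)‖ := by
    rw [Complex.norm_cpow_eq_rpow_re_of_pos Real.pi_pos]
    refine Real.rpow_le_rpow_of_exponent_le (by linarith [Real.pi_gt_three]) ?_
    simp
    linarith [(abs_le.1 hxA).2]
  -- assemble `‖γ(s)‖ ≥ c e^{-K y}`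
  have hΓ' : Real.pi * Real.exp (-(Real.pi * w.im)) * Real.exp (-(N * (S + N + w.im))) ≤
      ‖Complex.Gamma w‖ :=
    (mul_le_mul_of_nonneg_left hpoly (by positivity)).trans hΓ
  have hγ : c * Real.exp (-K * s.im) ≤ ‖xiGammaFactor s‖ := by
    have e1 : c * Real.exp (-K * s.im) =
        1 * (Real.pi ^ (-A / 2) * (Real.pi * Real.exp (-(Real.pi * w.im)) *
          Real.exp (-(N * (S + N + w.im))))) := by
      simp only [hc, hK, hwim]
      rw [one_mul, mul_assoc, mul_assoc, mul_assoc, ← Real.exp_add, ← Real.exp_add]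
      congr 2
      ring
    rw [e1, xiGammaFactor, Gammaℝ_def, norm_mul, norm_mul, hw] at *
    refine mul_le_mul hs1 (mul_le_mul hπ ?_ (by positivity) (norm_nonneg _)) (by positivity)
      (norm_nonneg _)
    simpa [hw] using hΓ'
  calc Real.exp (-(K + 1) * s.im) = Real.exp (-s.im) * Real.exp (-K * s.im) := by
        rw [← Real.exp_add]; ring_nf
    _ ≤ c * Real.exp (-K * s.im) := by
        refine mul_le_mul_of_nonneg_right ?_ (Real.exp_pos _).le
        rw [← Real.exp_log hcpos]
        apply Real.exp_le_exp.2
        have : Real.log (1 / c) = -Real.log c := by rw [one_div, Real.log_inv]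
        linarith
    _ ≤ ‖xiGammaFactor s‖ := hγ


/-! ## Limits used for the thresholds -/

/-- `2^{−(y^c/k − D)} → 0` for `c, k > 0`. [folklore] -/
theorem tendsto_two_rpow_neg {c k : ℝ} (hc : 0 < c) (hk : 0 < k) (D : ℝ) :
    Tendsto (fun y : ℝ ↦ (2 : ℝ) ^ (-(y ^ c / k - D))) atTop (𝓝 0) := by
  have h1 : Tendsto (fun y : ℝ ↦ y ^ c / k - D) atTop atTop :=
    tendsto_atTop_add_const_right _ _ ((tendsto_rpow_atTop hc).atTop_div_const hk)
  exact (tendsto_rpow_atBot_of_base_gt_one 2 (by norm_num)).comp (tendsto_neg_atTop_atBot.comp h1)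

/-- The exponent of the large-`n` tail tends to `−∞`:
`K' y − (y^{3/5}/10 − 2)(y^{3/5}/|t|) → −∞`. [folklore] -/
theorem tendsto_large_tail_exponent {K' τ : ℝ} (hτ : 0 < τ) :
    Tendsto (fun y : ℝ ↦ K' * y - (y ^ (3 / 5 : ℝ) / 10 - 2) * (y ^ (3 / 5 : ℝ) / τ)) atTop atBot := by
  -- compare with `−y`: for large `y`, `y^{1/5}/(10 τ) ≥ K' + 2/τ + 1`, and `y^{3/5} ≤ y`
  have h15 : Tendsto (fun y : ℝ ↦ y ^ (1 / 5 : ℝ)) atTop atTop := tendsto_rpow_atTop (by norm_num)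
  have hev : ∀ᶠ y : ℝ in atTop, K' * y - (y ^ (3 / 5 : ℝ) / 10 - 2) * (y ^ (3 / 5 : ℝ) / τ) ≤ -y := by
    filter_upwards [h15.eventually_ge_atTop ((|K'| + 2 / τ + 1) * (10 * τ)), eventually_ge_atTop (1 : ℝ)]
      with y hy hy1
    have hy0 : 0 < y := by linarith
    have e35 : y ^ (3 / 5 : ℝ) ≤ y := by
      conv_rhs => rw [← Real.rpow_one y]
      exact Real.rpow_le_rpow_of_exponent_le hy1 (by norm_num)
    have e35pos : 0 ≤ y ^ (3 / 5 : ℝ) := Real.rpow_nonneg hy0.le _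
    have e65 : y ^ (3 / 5 : ℝ) * y ^ (3 / 5 : ℝ) = y * y ^ (1 / 5 : ℝ) := by
      rw [← Real.rpow_add hy0, ← Real.rpow_one_add' hy0.le (by norm_num)]
      norm_num
    -- `(y^{3/5}/10)(y^{3/5}/τ) = y · y^{1/5}/(10 τ) ≥ y (|K'| + 2/τ + 1)`
    have key : y * (|K'| + 2 / τ + 1) ≤ (y ^ (3 / 5 : ℝ) / 10) * (y ^ (3 / 5 : ℝ) / τ) := by
      rw [div_mul_div_comm, e65, mul_div_assoc]
      refine mul_le_mul_of_nonneg_left ?_ hy0.le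
      rw [le_div_iff₀ (by positivity)]
      exact hy
    have h2 : 2 * (y ^ (3 / 5 : ℝ) / τ) ≤ 2 * (y / τ) := by gcongr
    have h3 : K' * y ≤ |K'| * y := mul_le_mul_of_nonneg_right (le_abs_self _) hy0.le
    have h4 : y * (|K'| + 2 / τ + 1) = |K'| * y + 2 * (y / τ) + y := by ring
    nlinarith
  refine tendsto_atBot_mono' atTop hev ?_
  exact tendsto_neg_atTop_atBot

/-! ## Norms of the main terms -/

/-- `‖γ_t(s) e^{−(|t|/4)log² n} n^{−s}‖ ≤ ‖γ_t(s)‖ ‖n`-th term of `ζ_t` at `a‖` for `a ≤ Re s`.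
[folklore] -/
theorem norm_dobnerMainTerm_le {t : ℝ} (ht : t < 0) {s : ℂ} (hs0 : s ≠ 0) {a : ℝ} (ha : a ≤ s.re)
    (n : ℕ) :
    ‖dobnerMainTerm t n s‖ ≤ ‖dobnerGammaT t s‖ * ‖LSeries.term (zetaDeformedCoeff t) a n‖ := by
  rw [dobnerMainTerm_eq ht n hs0, norm_mul]
  exact mul_le_mul_of_nonneg_left (LSeries.norm_term_le_of_re_le_re _ (by simpa using ha) n)
    (norm_nonneg _)

/-- `‖γ_t(s) e^{−(|t|/4)log² n} n^{−s}‖ = ‖γ_t(s)‖ e^{−(|t|/4)log² n} n^{−Re s}` for `n ≥ 1`. [folklore] -/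
theorem norm_dobnerMainTerm_eq {t : ℝ} (ht : t < 0) {s : ℂ} (hs0 : s ≠ 0) {n : ℕ} (hn : 1 ≤ n) :
    ‖dobnerMainTerm t n s‖ =
      ‖dobnerGammaT t s‖ * (Real.exp (-(|t| / 4) * Real.log n ^ 2) * (n : ℝ) ^ (-s.re)) := by
  rw [dobnerMainTerm_eq ht n hs0, norm_mul, LSeries.norm_term_eq, if_neg (by omega),
    zetaDeformedCoeff, Complex.norm_real, Real.norm_eq_abs, abs_of_pos (Real.exp_pos _),
    Real.rpow_neg (Nat.cast_nonneg n), div_eq_mul_inv]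
  congr 2
  rw [abs_of_neg ht]
  ring_nf

/-- `e^{−cL²} n^{−x} = n^{−(cL + x)}`, `L = log n`, `n ≥ 1`. [folklore] -/
theorem exp_neg_mul_log_sq_mul_rpow {n : ℕ} (hn : 1 ≤ n) (c x : ℝ) :
    Real.exp (-c * Real.log n ^ 2) * (n : ℝ) ^ (-x) = (n : ℝ) ^ (-(c * Real.log n + x)) := by
  have hnpos : (0 : ℝ) < n := by exact_mod_cast hn
  rw [exp_neg_mul_log_sq hn, ← Real.rpow_add hnpos]
  congr 1; ring

/-- `γ_t(s) e^{0} 0^{−s} = 0` for `s ≠ 0`. [folklore] -/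
theorem dobnerMainTerm_zero {t : ℝ} (ht : t < 0) {s : ℂ} (hs0 : s ≠ 0) : dobnerMainTerm t 0 s = 0 := by
  rw [dobnerMainTerm_eq ht 0 hs0]; simp

/-! ## The two term-wise bounds of §4.1 -/

/-- **Small and medium `n`** (Lemma 4 (i), (ii)): for `1 ≤ n` with `log n ≤ y^{3/5}/|t|`,
`‖B_{t,n} − main‖ ≤ |γ_t| (K y^{−1/5} |term_a n| + (K+1) n^{−2} 2^{−(p−2)})`, `p = y^{1/3}/8 − C`.
[cite: Dobner2021, §4.1] -/
theorem norm_dobnerB_sub_mainTerm_le_small {t : ℝ} (ht : t < 0) {s : ℂ} (hs0 : s ≠ 0)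
    {K C a : ℝ} (hK : 0 < K) (hxC : -C < s.re) (ha : a ≤ s.re) (hy : 0 < s.im) {n : ℕ} (hn : 1 ≤ n)
    (hi : Real.log n ≤ s.im ^ (1 / 3 : ℝ) / |t| →
      ‖dobnerB t n s - dobnerMainTerm t n s‖ ≤ K * s.im ^ (-(1 / 5 : ℝ)) * ‖dobnerMainTerm t n s‖)
    (hii : Real.log n ≤ s.im ^ (3 / 5 : ℝ) / |t| →
      ‖dobnerB t n s‖ ≤ K * ‖dobnerGammaT t s‖ * Real.exp (-(|t| / 8) * Real.log n ^ 2) *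
        (n : ℝ) ^ (-s.re))
    (hlog35 : Real.log n ≤ s.im ^ (3 / 5 : ℝ) / |t|) (hp2 : 2 ≤ s.im ^ (1 / 3 : ℝ) / 8 - C) :
    ‖dobnerB t n s - dobnerMainTerm t n s‖ ≤
      ‖dobnerGammaT t s‖ * (K * s.im ^ (-(1 / 5 : ℝ)) * ‖LSeries.term (zetaDeformedCoeff t) a n‖) +
      ‖dobnerGammaT t s‖ * ((K + 1) * ((n : ℝ) ^ (-2 : ℝ) *
        (2 : ℝ) ^ (-(s.im ^ (1 / 3 : ℝ) / 8 - C - 2)))) := by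
  have ht' : 0 < |t| := abs_pos.2 ht.ne
  set γn : ℝ := ‖dobnerGammaT t s‖ with hγn
  have hγ0 : 0 ≤ γn := norm_nonneg _
  set p : ℝ := s.im ^ (1 / 3 : ℝ) / 8 - C with hp
  have hnpos : (0 : ℝ) < n := by exact_mod_cast hn
  have hT1 : 0 ≤ γn * (K * s.im ^ (-(1 / 5 : ℝ)) * ‖LSeries.term (zetaDeformedCoeff t) a n‖) := by
    positivity
  have hT2 : 0 ≤ γn * ((K + 1) * ((n : ℝ) ^ (-2 : ℝ) * (2 : ℝ) ^ (-(p - 2)))) := by positivity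
  by_cases hsmall : Real.log n ≤ s.im ^ (1 / 3 : ℝ) / |t|
  · have h := hi hsmall
    calc ‖dobnerB t n s - dobnerMainTerm t n s‖
        ≤ K * s.im ^ (-(1 / 5 : ℝ)) * ‖dobnerMainTerm t n s‖ := h
      _ ≤ K * s.im ^ (-(1 / 5 : ℝ)) * (γn * ‖LSeries.term (zetaDeformedCoeff t) a n‖) :=
          mul_le_mul_of_nonneg_left (norm_dobnerMainTerm_le ht hs0 ha n) (by positivity)
      _ = γn * (K * s.im ^ (-(1 / 5 : ℝ)) * ‖LSeries.term (zetaDeformedCoeff t) a n‖) := by ring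
      _ ≤ _ := le_add_of_nonneg_right hT2
  · push Not at hsmall
    have hn2 : 2 ≤ n := by
      by_contra h2
      have : n = 1 := by omega
      subst this
      simp at hsmall
      linarith [show 0 ≤ s.im ^ (1 / 3 : ℝ) / |t| by positivity]
    have hBn := hii hlog35
    have hmnn : ‖dobnerMainTerm t n s‖ ≤ γn * (Real.exp (-(|t| / 8) * Real.log n ^ 2) * (n : ℝ) ^ (-s.re)) := by
      rw [norm_dobnerMainTerm_eq ht hs0 hn]
      refine mul_le_mul_of_nonneg_left (mul_le_mul_of_nonneg_right (Real.exp_le_exp.2 ?_)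
        (Real.rpow_nonneg hnpos.le _)) hγ0
      nlinarith [sq_nonneg (Real.log n)]
    have hexp : Real.exp (-(|t| / 8) * Real.log n ^ 2) * (n : ℝ) ^ (-s.re) ≤
        (n : ℝ) ^ (-2 : ℝ) * (2 : ℝ) ^ (-(p - 2)) := by
      rw [exp_neg_mul_log_sq_mul_rpow hn]
      have h1 : (n : ℝ) ^ (-(|t| / 8 * Real.log n + s.re)) ≤ (n : ℝ) ^ (-p) := by
        refine Real.rpow_le_rpow_of_exponent_le (by exact_mod_cast hn) ?_
        have : s.im ^ (1 / 3 : ℝ) / 8 < |t| / 8 * Real.log n := by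
          have := mul_lt_mul_of_pos_left hsmall (by positivity : (0 : ℝ) < |t| / 8)
          rwa [show |t| / 8 * (s.im ^ (1 / 3 : ℝ) / |t|) = s.im ^ (1 / 3 : ℝ) / 8 by field_simp] at this
        rw [hp]; linarith
      exact h1.trans (rpow_neg_le_inv_sq_mul hn2 hp2)
    calc ‖dobnerB t n s - dobnerMainTerm t n s‖
        ≤ ‖dobnerB t n s‖ + ‖dobnerMainTerm t n s‖ := norm_sub_le _ _
      _ ≤ K * γn * Real.exp (-(|t| / 8) * Real.log n ^ 2) * (n : ℝ) ^ (-s.re) +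
          γn * (Real.exp (-(|t| / 8) * Real.log n ^ 2) * (n : ℝ) ^ (-s.re)) := add_le_add hBn hmnn
      _ = (K + 1) * γn * (Real.exp (-(|t| / 8) * Real.log n ^ 2) * (n : ℝ) ^ (-s.re)) := by ring
      _ ≤ (K + 1) * γn * ((n : ℝ) ^ (-2 : ℝ) * (2 : ℝ) ^ (-(p - 2))) :=
          mul_le_mul_of_nonneg_left hexp (by positivity)
      _ = γn * ((K + 1) * ((n : ℝ) ^ (-2 : ℝ) * (2 : ℝ) ^ (-(p - 2)))) := by ring
      _ ≤ _ := le_add_of_nonneg_left hT1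

/-- **Large `n`** (Lemma 4 (iii)): for `n > e^{y^{3/5}/|t|}`,
`‖B_{t,n} − main‖ ≤ K n^{−2} e^{−(r−2) y^{3/5}/|t|} + |γ_t| n^{−2} 2^{−(q−2)}`,
`r = y^{3/5}/10 ≥ 4`, `q = y^{3/5}/4 − C ≥ 2`. [cite: Dobner2021, §4.1] -/
theorem norm_dobnerB_sub_mainTerm_le_large {t : ℝ} (ht : t < 0) {s : ℂ} (hs0 : s ≠ 0)
    {K C : ℝ} (hK : 0 < K) (hxC : -C < s.re) (hy : 0 < s.im) {n : ℕ}
    (hngt : Real.exp (s.im ^ (3 / 5 : ℝ) / |t|) < n)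
    (hiii : s.im ^ (3 / 5 : ℝ) / |t| < Real.log n →
      ‖dobnerB t n s‖ ≤ K * Real.exp (-(|t| / 10) * Real.log n ^ 2))
    (hr4 : 4 ≤ s.im ^ (3 / 5 : ℝ) / 10) (hq2 : 2 ≤ s.im ^ (3 / 5 : ℝ) / 4 - C) :
    ‖dobnerB t n s - dobnerMainTerm t n s‖ ≤
      K * ((n : ℝ) ^ (-2 : ℝ) *
        Real.exp (-(s.im ^ (3 / 5 : ℝ) / 10 - 2) * (s.im ^ (3 / 5 : ℝ) / |t|))) +
      ‖dobnerGammaT t s‖ * ((n : ℝ) ^ (-2 : ℝ) * (2 : ℝ) ^ (-(s.im ^ (3 / 5 : ℝ) / 4 - C - 2))) := by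
  have ht' : 0 < |t| := abs_pos.2 ht.ne
  set γn : ℝ := ‖dobnerGammaT t s‖ with hγn
  have hγ0 : 0 ≤ γn := norm_nonneg _
  set r : ℝ := s.im ^ (3 / 5 : ℝ) / 10 with hr
  set q : ℝ := s.im ^ (3 / 5 : ℝ) / 4 - C with hq
  have hexp1 : 1 ≤ Real.exp (s.im ^ (3 / 5 : ℝ) / |t|) := Real.one_le_exp (by positivity)
  have hn1' : (1 : ℝ) < n := hexp1.trans_lt hngt
  have hn2 : 2 ≤ n := by exact_mod_cast hn1'
  have hn : 1 ≤ n := by omega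
  have hnpos : (0 : ℝ) < n := by exact_mod_cast hn
  have hlog : s.im ^ (3 / 5 : ℝ) / |t| < Real.log n := (Real.lt_log_iff_exp_lt hnpos).2 hngt
  have hBn := hiii hlog
  have h1 : Real.exp (-(|t| / 10) * Real.log n ^ 2) ≤
      (n : ℝ) ^ (-2 : ℝ) * Real.exp (-(r - 2) * (s.im ^ (3 / 5 : ℝ) / |t|)) := by
    rw [exp_neg_mul_log_sq hn]
    have hrl : r < |t| / 10 * Real.log n := by
      have := mul_lt_mul_of_pos_left hlog (by positivity : (0 : ℝ) < |t| / 10)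
      rwa [show |t| / 10 * (s.im ^ (3 / 5 : ℝ) / |t|) = r by rw [hr]; field_simp] at this
    calc (n : ℝ) ^ (-(|t| / 10) * Real.log n) ≤ (n : ℝ) ^ (-r) :=
          Real.rpow_le_rpow_of_exponent_le (by exact_mod_cast hn) (by linarith)
      _ = (n : ℝ) ^ (-2 : ℝ) * (n : ℝ) ^ (-(r - 2)) := by
          rw [← Real.rpow_add hnpos]; congr 1; ring
      _ ≤ (n : ℝ) ^ (-2 : ℝ) * (Real.exp (s.im ^ (3 / 5 : ℝ) / |t|)) ^ (-(r - 2)) := by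
          refine mul_le_mul_of_nonneg_left ?_ (Real.rpow_nonneg hnpos.le _)
          exact Real.rpow_le_rpow_of_nonpos (Real.exp_pos _) hngt.le (by linarith)
      _ = (n : ℝ) ^ (-2 : ℝ) * Real.exp (-(r - 2) * (s.im ^ (3 / 5 : ℝ) / |t|)) := by
          rw [← Real.exp_mul]; congr 1; congr 1; ring
  have h2 : ‖dobnerMainTerm t n s‖ ≤ γn * ((n : ℝ) ^ (-2 : ℝ) * (2 : ℝ) ^ (-(q - 2))) := by
    rw [norm_dobnerMainTerm_eq ht hs0 hn, exp_neg_mul_log_sq_mul_rpow hn]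
    refine mul_le_mul_of_nonneg_left ?_ hγ0
    have hq' : (n : ℝ) ^ (-(|t| / 4 * Real.log n + s.re)) ≤ (n : ℝ) ^ (-q) := by
      refine Real.rpow_le_rpow_of_exponent_le (by exact_mod_cast hn) ?_
      have : s.im ^ (3 / 5 : ℝ) / 4 < |t| / 4 * Real.log n := by
        have := mul_lt_mul_of_pos_left hlog (by positivity : (0 : ℝ) < |t| / 4)
        rwa [show |t| / 4 * (s.im ^ (3 / 5 : ℝ) / |t|) = s.im ^ (3 / 5 : ℝ) / 4 by field_simp] at this
      rw [hq]; linarith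
    exact hq'.trans (rpow_neg_le_inv_sq_mul hn2 hq2)
  calc ‖dobnerB t n s - dobnerMainTerm t n s‖ ≤ ‖dobnerB t n s‖ + ‖dobnerMainTerm t n s‖ :=
        norm_sub_le _ _
    _ ≤ _ := add_le_add (hBn.trans (mul_le_mul_of_nonneg_left h1 hK.le)) h2

/-! ## Thm. 4 (qualitative) from Lemma 4 -/

set_option maxHeartbeats 400000 in
/-- **Dobner's Thm. 4, qualitative version, from Lemma 4 and the series representation**
(§4.1 of the source, for `F = ζ`): split `ξ_t(J_t(s)) = Σ_n B_{t,n}(s)` at `log n = y^{1/3}/|t|`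
and `log n = y^{3/5}/|t|`; Lemma 4 (i) controls the small `n` by `y^{−1/5} ζ̃_t(a)`, (ii) the medium
`n` by a tail `Σ n^{−(y^{1/3}/8 − C)}`, (iii) the large `n` by `e^{−(y^{3/5}/10 − 2) y^{3/5}/|t|}`,
which after division by `|γ_t(s)| ≥ e^{−π²|t|/16} e^{−K'y}` (eq. (4.9); here from
`exists_exp_neg_le_norm_xiGammaFactor`) still tends to `0`. [cite: Dobner2021, §4.1] -/
theorem dobner_xiDeformed_approx_of_lemma4 (h4 : dobner_lemma4) : dobner_xiDeformed_approx := by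
  intro t ht a b hab ε hε
  have ht' : 0 < |t| := abs_pos.2 ht.ne
  -- constants
  set C : ℝ := max (max |a| |b|) 1 + 1 with hC
  have hC1 : 1 ≤ C := by rw [hC]; linarith [le_max_right (max |a| |b|) 1]
  have hC0 : 0 < C := by linarith
  have hCa : |a| ≤ C - 1 := by rw [hC]; linarith [le_max_left |a| |b|, le_max_left (max |a| |b|) 1]
  have hCb : |b| ≤ C - 1 := by rw [hC]; linarith [le_max_right |a| |b|, le_max_left (max |a| |b|) 1]
  obtain ⟨y₁, K, hK, hL4⟩ := h4 t ht C hC0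
  obtain ⟨K₁', y₂, hK₁', hL1⟩ := exists_exp_neg_le_norm_xiGammaFactor a b
  set Z : ℝ := ∑' n : ℕ, ‖LSeries.term (zetaDeformedCoeff t) a n‖ with hZ
  have hZs : Summable fun n : ℕ ↦ ‖LSeries.term (zetaDeformedCoeff t) a n‖ :=
    (zetaDeformed_summable ht a).norm
  have hZ0 : 0 ≤ Z := tsum_nonneg fun n ↦ norm_nonneg _
  set c₀ : ℝ := Real.exp (-(Real.pi ^ 2 * |t| / 16)) with hc₀
  have hc₀pos : 0 < c₀ := Real.exp_pos _
  -- the error function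
  obtain ⟨Err, hErr_def, hErr0⟩ : ∃ Err : ℝ → ℝ, (∀ y, Err y = K * Z * y ^ (-(1 / 5 : ℝ)) +
      2 * (K + 1) * (2 : ℝ) ^ (-(y ^ (1 / 3 : ℝ) / 8 - C - 2)) +
      2 * (2 : ℝ) ^ (-(y ^ (3 / 5 : ℝ) / 4 - C - 2)) +
      2 * K / c₀ * Real.exp (K₁' * y - (y ^ (3 / 5 : ℝ) / 10 - 2) * (y ^ (3 / 5 : ℝ) / |t|))) ∧
      Tendsto Err atTop (𝓝 0) := by
    refine ⟨_, fun y ↦ rfl, ?_⟩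
    have e1 := (tendsto_rpow_neg_atTop (by norm_num : (0 : ℝ) < 1 / 5)).const_mul (K * Z)
    have e2 := (tendsto_two_rpow_neg (by norm_num : (0 : ℝ) < 1 / 3) (by norm_num : (0 : ℝ) < 8)
      (C + 2)).const_mul (2 * (K + 1))
    have e3 := (tendsto_two_rpow_neg (by norm_num : (0 : ℝ) < 3 / 5) (by norm_num : (0 : ℝ) < 4)
      (C + 2)).const_mul 2
    have e4 := (Real.tendsto_exp_atBot.comp (tendsto_large_tail_exponent (K' := K₁') ht')).const_mul
      (2 * K / c₀)
    simp only [mul_zero] at e1 e2 e3 e4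
    have := ((e1.add e2).add e3).add e4
    simp only [add_zero] at this
    refine this.congr fun y ↦ ?_
    simp only [Function.comp]
    ring_nf
  -- thresholds
  have hev : ∀ᶠ y : ℝ in atTop, Err y < ε ∧ y₁ ≤ y ∧ y₂ ≤ y ∧ 1 ≤ y ∧
      2 ≤ y ^ (1 / 3 : ℝ) / 8 - C ∧ 2 ≤ y ^ (3 / 5 : ℝ) / 4 - C ∧ 4 ≤ y ^ (3 / 5 : ℝ) / 10 := by
    have t13 : Tendsto (fun y : ℝ ↦ y ^ (1 / 3 : ℝ) / 8 - C) atTop atTop :=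
      tendsto_atTop_add_const_right _ _ ((tendsto_rpow_atTop (by norm_num)).atTop_div_const (by norm_num))
    have t35 : Tendsto (fun y : ℝ ↦ y ^ (3 / 5 : ℝ) / 4 - C) atTop atTop :=
      tendsto_atTop_add_const_right _ _ ((tendsto_rpow_atTop (by norm_num)).atTop_div_const (by norm_num))
    have t35' : Tendsto (fun y : ℝ ↦ y ^ (3 / 5 : ℝ) / 10) atTop atTop :=
      (tendsto_rpow_atTop (by norm_num)).atTop_div_const (by norm_num)
    filter_upwards [hErr0.eventually (gt_mem_nhds hε), eventually_ge_atTop y₁, eventually_ge_atTop y₂,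
      eventually_ge_atTop (1 : ℝ), t13.eventually_ge_atTop 2, t35.eventually_ge_atTop 2,
      t35'.eventually_ge_atTop 4] with y h1 h2 h3 h4 h5 h6 h7
    exact ⟨h1, h2, h3, h4, h5, h6, h7⟩
  obtain ⟨y₀, hy₀⟩ := eventually_atTop.1 hev
  refine ⟨y₀, fun s hsa hsb hsy ↦ ?_⟩
  -- fix `s = x + iy`
  set x : ℝ := s.re with hx
  set y : ℝ := s.im with hy
  obtain ⟨hErrε, hyy₁, hyy₂, hy1, hp2, hq2, hr4⟩ := hy₀ y hsy
  have hy0 : 0 < y := by linarith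
  have hs0 : s ≠ 0 := fun h ↦ by
    have : y = 0 := by rw [hy, h]; simp
    linarith
  have hxC' : |x| ≤ C - 1 := by
    rw [abs_le]; rw [abs_le] at hCa hCb; constructor <;> linarith
  have hxC : |x| ≤ C * y ^ (1 / 4 : ℝ) := by
    have : (1 : ℝ) ≤ y ^ (1 / 4 : ℝ) := Real.one_le_rpow hy1 (by norm_num)
    nlinarith
  -- Lemma 4 at `s` and the lower bound for `γ(s)`
  have hL4s := hL4 s hxC hyy₁
  have hγlow : Real.exp (-K₁' * y) ≤ ‖xiGammaFactor s‖ := hL1 s hsa hsb hyy₂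
  set γn : ℝ := ‖dobnerGammaT t s‖ with hγn
  have hγt : c₀ * Real.exp (-K₁' * y) ≤ γn := by
    rw [hγn, dobnerGammaT, norm_mul, Complex.norm_exp, mul_comm]
    refine mul_le_mul hγlow ?_ hc₀pos.le (norm_nonneg _)
    exact Real.exp_le_exp.2 (re_sq_sub_dobnerJ_ge t s)
  have hγpos : 0 < γn := lt_of_lt_of_le (by positivity) hγt
  -- the pieces of the sum
  set mn : ℕ → ℂ := fun n ↦ dobnerMainTerm t n s with hmn
  set B : ℕ → ℂ := fun n ↦ dobnerB t n s with hB
  set d : ℕ → ℂ := fun n ↦ B n - mn n with hd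
  have hmn_fun : mn = fun n ↦ dobnerGammaT t s * LSeries.term (zetaDeformedCoeff t) s n :=
    funext fun n ↦ dobnerMainTerm_eq ht n hs0
  have hmn_sum : Summable mn := by rw [hmn_fun]; exact (zetaDeformed_summable ht s).mul_left _
  have hmn_tsum : ∑' n, mn n = dobnerGammaT t s * zetaDeformed t s := by
    rw [hmn_fun, tsum_mul_left]; rfl
  -- exponents and the cut-off `N₂`
  set N₂ : ℕ := ⌊Real.exp (y ^ (3 / 5 : ℝ) / |t|)⌋₊ with hN₂
  have hxge : -C < x := by linarith [(abs_le.1 hxC').1]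
  have hsa' : a ≤ s.re := hsa
  -- (A) the terms with `n ≤ N₂`
  have hA : ∀ n : ℕ, n ≤ N₂ → ‖d n‖ ≤
      γn * (K * y ^ (-(1 / 5 : ℝ)) * ‖LSeries.term (zetaDeformedCoeff t) a n‖) +
      γn * ((K + 1) * ((n : ℝ) ^ (-2 : ℝ) * (2 : ℝ) ^ (-(y ^ (1 / 3 : ℝ) / 8 - C - 2)))) := by
    intro n hnN
    rcases Nat.eq_zero_or_pos n with rfl | hn
    · have : d 0 = 0 := by simp only [hd, hB, hmn, dobnerB_zero t s, dobnerMainTerm_zero ht hs0, sub_zero]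
      rw [this, norm_zero]
      positivity
    have hlog35 : Real.log n ≤ y ^ (3 / 5 : ℝ) / |t| := by
      rw [Real.log_le_iff_le_exp (by exact_mod_cast hn)]
      exact (show (n : ℝ) ≤ N₂ by exact_mod_cast hnN).trans (Nat.floor_le (by positivity))
    obtain ⟨hi, hii, -⟩ := hL4s n hn
    exact norm_dobnerB_sub_mainTerm_le_small ht hs0 hK hxge hsa' hy0 hn hi hii hlog35 hp2
  -- (B) the terms with `n > N₂`
  set E₃ : ℝ := Real.exp (-(y ^ (3 / 5 : ℝ) / 10 - 2) * (y ^ (3 / 5 : ℝ) / |t|)) with hE₃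
  have hBB : ∀ m : ℕ, ‖d (m + (N₂ + 1))‖ ≤
      K * (((m + (N₂ + 1) : ℕ) : ℝ) ^ (-2 : ℝ) * E₃) +
      γn * (((m + (N₂ + 1) : ℕ) : ℝ) ^ (-2 : ℝ) * (2 : ℝ) ^ (-(y ^ (3 / 5 : ℝ) / 4 - C - 2))) := by
    intro m
    have hngt : Real.exp (y ^ (3 / 5 : ℝ) / |t|) < ((m + (N₂ + 1) : ℕ) : ℝ) := by
      refine (Nat.lt_floor_add_one (Real.exp (y ^ (3 / 5 : ℝ) / |t|))).trans_le ?_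
      rw [← hN₂]; exact_mod_cast (show N₂ + 1 ≤ m + (N₂ + 1) by omega)
    obtain ⟨-, -, hiii⟩ := hL4s (m + (N₂ + 1)) (by omega)
    exact norm_dobnerB_sub_mainTerm_le_large ht hs0 hK hxge hy0 hngt hiii hr4 hq2
  -- summability of `‖d‖`
  have hsq2 : Summable fun m : ℕ ↦ (((m + (N₂ + 1) : ℕ) : ℝ) ^ (-2 : ℝ)) :=
    (summable_nat_add_iff (N₂ + 1)).2 summable_nat_rpow_neg_two
  have hdn_tail : Summable fun m : ℕ ↦ ‖d (m + (N₂ + 1))‖ :=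
    Summable.of_nonneg_of_le (fun m ↦ norm_nonneg _) hBB
      (((hsq2.mul_right E₃).mul_left K).add ((hsq2.mul_right _).mul_left γn))
  have hdn : Summable fun n : ℕ ↦ ‖d n‖ := (summable_nat_add_iff (N₂ + 1)).1 hdn_tail
  have hds : Summable d := hdn.of_norm
  -- the identity `ξ_t(J) − γ_t ζ_t = Σ d`
  have hBs : Summable B := by
    have : B = fun n ↦ d n + mn n := by funext n; simp [hd]
    rw [this]; exact hds.add hmn_sum
  have hrepr := xiDeformed_dobnerJ_eq_tsum_dobnerB ht s
  have hdiff : xiDeformed t (dobnerJ t s) - dobnerGammaT t s * zetaDeformed t s = ∑' n, d n := by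
    rw [hrepr, ← hmn_tsum, ← Summable.tsum_sub hBs hmn_sum]
  -- estimate
  rw [hdiff]
  have hsplit := hdn.sum_add_tsum_nat_add (N₂ + 1)
  have hZpart : ∑ n ∈ Finset.range (N₂ + 1), ‖LSeries.term (zetaDeformedCoeff t) a n‖ ≤ Z :=
    hZs.sum_le_tsum _ fun n _ ↦ norm_nonneg _
  have h2part : ∑ n ∈ Finset.range (N₂ + 1), (n : ℝ) ^ (-2 : ℝ) ≤ 2 :=
    (summable_nat_rpow_neg_two.sum_le_tsum _ fun n _ ↦ Real.rpow_nonneg n.cast_nonneg _).trans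
      tsum_nat_rpow_neg_two_le
  have h2tail : ∑' m : ℕ, (((m + (N₂ + 1) : ℕ) : ℝ) ^ (-2 : ℝ)) ≤ 2 := by
    have h := summable_nat_rpow_neg_two.sum_add_tsum_nat_add (N₂ + 1)
    have hnn : 0 ≤ ∑ n ∈ Finset.range (N₂ + 1), (n : ℝ) ^ (-2 : ℝ) :=
      Finset.sum_nonneg fun n _ ↦ Real.rpow_nonneg n.cast_nonneg _
    linarith [tsum_nat_rpow_neg_two_le]
  have hhead : ∑ n ∈ Finset.range (N₂ + 1), ‖d n‖ ≤
      γn * (K * y ^ (-(1 / 5 : ℝ)) * Z) + γn * ((K + 1) * (2 * (2 : ℝ) ^ (-(y ^ (1 / 3 : ℝ) / 8 - C - 2)))) := by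
    calc ∑ n ∈ Finset.range (N₂ + 1), ‖d n‖
        ≤ ∑ n ∈ Finset.range (N₂ + 1),
            (γn * (K * y ^ (-(1 / 5 : ℝ)) * ‖LSeries.term (zetaDeformedCoeff t) a n‖) +
             γn * ((K + 1) * ((n : ℝ) ^ (-2 : ℝ) * (2 : ℝ) ^ (-(y ^ (1 / 3 : ℝ) / 8 - C - 2))))) :=
          Finset.sum_le_sum fun n hn ↦ hA n (by rw [Finset.mem_range] at hn; omega)
      _ = γn * (K * y ^ (-(1 / 5 : ℝ)) * ∑ n ∈ Finset.range (N₂ + 1), ‖LSeries.term (zetaDeformedCoeff t) a n‖) +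
          γn * ((K + 1) * ((∑ n ∈ Finset.range (N₂ + 1), (n : ℝ) ^ (-2 : ℝ)) * (2 : ℝ) ^ (-(y ^ (1 / 3 : ℝ) / 8 - C - 2)))) := by
          rw [Finset.sum_add_distrib, ← Finset.mul_sum, ← Finset.mul_sum, ← Finset.mul_sum,
            ← Finset.mul_sum, ← Finset.sum_mul]
      _ ≤ γn * (K * y ^ (-(1 / 5 : ℝ)) * Z) + γn * ((K + 1) * (2 * (2 : ℝ) ^ (-(y ^ (1 / 3 : ℝ) / 8 - C - 2)))) := by
          gcongr
  have htail : ∑' m : ℕ, ‖d (m + (N₂ + 1))‖ ≤ K * (2 * E₃) + γn * (2 * (2 : ℝ) ^ (-(y ^ (3 / 5 : ℝ) / 4 - C - 2))) := by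
    calc ∑' m : ℕ, ‖d (m + (N₂ + 1))‖
        ≤ ∑' m : ℕ, (K * ((((m + (N₂ + 1) : ℕ) : ℝ) ^ (-2 : ℝ)) * E₃) +
            γn * ((((m + (N₂ + 1) : ℕ) : ℝ) ^ (-2 : ℝ)) * (2 : ℝ) ^ (-(y ^ (3 / 5 : ℝ) / 4 - C - 2)))) :=
          Summable.tsum_le_tsum hBB hdn_tail
            (((hsq2.mul_right E₃).mul_left K).add ((hsq2.mul_right _).mul_left γn))
      _ = K * ((∑' m : ℕ, (((m + (N₂ + 1) : ℕ) : ℝ) ^ (-2 : ℝ))) * E₃) +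
          γn * ((∑' m : ℕ, (((m + (N₂ + 1) : ℕ) : ℝ) ^ (-2 : ℝ))) * (2 : ℝ) ^ (-(y ^ (3 / 5 : ℝ) / 4 - C - 2))) := by
          rw [Summable.tsum_add ((hsq2.mul_right E₃).mul_left K) ((hsq2.mul_right _).mul_left γn),
            tsum_mul_left, tsum_mul_left, tsum_mul_right, tsum_mul_right]
      _ ≤ K * (2 * E₃) + γn * (2 * (2 : ℝ) ^ (-(y ^ (3 / 5 : ℝ) / 4 - C - 2))) := by
          gcongr
  -- divide the large-`n` bound by `γn`
  have hE₃γ : K * (2 * E₃) ≤ γn * (2 * K / c₀ *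
      Real.exp (K₁' * y - (y ^ (3 / 5 : ℝ) / 10 - 2) * (y ^ (3 / 5 : ℝ) / |t|))) := by
    have e : Real.exp (K₁' * y - (y ^ (3 / 5 : ℝ) / 10 - 2) * (y ^ (3 / 5 : ℝ) / |t|)) =
        Real.exp (K₁' * y) * E₃ := by
      rw [hE₃, ← Real.exp_add]; congr 1; ring
    rw [e]
    have h1 : 1 ≤ γn * (Real.exp (K₁' * y) / c₀) := by
      rw [mul_div_assoc', le_div_iff₀ hc₀pos, one_mul]
      calc c₀ = c₀ * Real.exp (-K₁' * y) * Real.exp (K₁' * y) := by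
            rw [mul_assoc, ← Real.exp_add]; simp
        _ ≤ γn * Real.exp (K₁' * y) := mul_le_mul_of_nonneg_right hγt (Real.exp_pos _).le
    have hE0 : 0 ≤ E₃ := (Real.exp_pos _).le
    calc K * (2 * E₃) = K * (2 * E₃) * 1 := by ring
      _ ≤ K * (2 * E₃) * (γn * (Real.exp (K₁' * y) / c₀)) :=
          mul_le_mul_of_nonneg_left h1 (by positivity)
      _ = γn * (2 * K / c₀ * (Real.exp (K₁' * y) * E₃)) := by
          field_simp
  -- conclusion
  have hErr_y := hErr_def y
  calc ‖∑' n, d n‖ ≤ ∑' n, ‖d n‖ := norm_tsum_le_tsum_norm hdn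
    _ = ∑ n ∈ Finset.range (N₂ + 1), ‖d n‖ + ∑' m : ℕ, ‖d (m + (N₂ + 1))‖ := hsplit.symm
    _ ≤ γn * (K * y ^ (-(1 / 5 : ℝ)) * Z) + γn * ((K + 1) * (2 * (2 : ℝ) ^ (-(y ^ (1 / 3 : ℝ) / 8 - C - 2)))) +
        (K * (2 * E₃) + γn * (2 * (2 : ℝ) ^ (-(y ^ (3 / 5 : ℝ) / 4 - C - 2)))) := add_le_add hhead htail
    _ ≤ γn * (K * y ^ (-(1 / 5 : ℝ)) * Z) + γn * ((K + 1) * (2 * (2 : ℝ) ^ (-(y ^ (1 / 3 : ℝ) / 8 - C - 2)))) +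
        (γn * (2 * K / c₀ * Real.exp (K₁' * y - (y ^ (3 / 5 : ℝ) / 10 - 2) * (y ^ (3 / 5 : ℝ) / |t|))) +
          γn * (2 * (2 : ℝ) ^ (-(y ^ (3 / 5 : ℝ) / 4 - C - 2)))) := by gcongr
    _ = γn * Err y := by rw [hErr_y]; ring
    _ ≤ γn * ε := mul_le_mul_of_nonneg_left hErrε.le hγpos.le
    _ = ε * ‖dobnerGammaT t s‖ := by rw [hγn, mul_comm]

/-- **Newman's conjecture `Λ ≥ 0` (`Literature.NumberTheory.LFunctions.rodgers_tao`) from Dobner's Lemma 4 alone**: with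
Lemma 3 (`DobnerLemma3Proofs.lean`), Bohr's theorem (`BohrAlmostPeriodicProofs.lean`), §3.1
(`DobnerNewmanProofs.lean`), §4.1 and the `γ` lower bound (this file) proved, the only remaining
input of Dobner's route is the steepest-descent Lemma 4 (`Literature.NumberTheory.LFunctions.dobner_lemma4`).
[cite: Dobner2021, Thm. 2] -/
theorem rodgers_tao_of_dobner_lemma4 (h4 : dobner_lemma4) : LFunctions.rodgers_tao :=
  LFunctions.rodgers_tao_of_dobner_thm4 (dobner_xiDeformed_approx_of_lemma4 h4)

end Literature.NumberTheory.LFunctions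

end
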